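import Summits.QuantumAdvantage.QuantumAdvantage.Theorems.CubicForrelationNearExactIsExactKtGapTwoStep

/-!
# Crux `CubicForrelation.NearExactIsExact` (stmt-QuantumAdvantage-14043) — Kasami–Tokura for CUBICS below `2d`, V: the factorised form
  `c = 1_H · q` of a cubic supported inside an affine hyperplane `H` (`q` a quadratic, periodic in a transversal direction)

Certificate seat `b2b-cforr-cert` (gen 19).  HONEST FRAMING: an elementary structure lemma (standard axioms, uniform in the number of bits) that
turns the conclusion of `…KtThreeStructure.kt3_structure` ("the support lies in `{⟨x,z⟩ = b}`") into the coordinate-free form of Kasami–Tokura's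
type `x₁·q`: `c(x) = [⟨x,z⟩ = b] ∧ q(x)` with `q = c ⊕ c(·⊕v)` of degree `≤ 2` and `v`-periodic, for any `v` with `⟨v,z⟩ = 1`.  Intended use:
the type-O base set `E = {d₁ = d₂}` of the `n = 12` ladder with `#E = 960` or `512` (`…TwelveTypeO931Shape`) is `H ∩ {q = 1}` for a quadratic
`q` — the structure the `T1`-type partner analyses need.  NOT summit progress.

References: T. Kasami, N. Tokura (1970) Thm 1 (type `x₁⋯x_{r−2}·(quadratic)`); MacWilliams–Sloane (1977) Ch. 15 §3.  Axioms: the standard three.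
-/

set_option linter.dupNamespace false -- D-0017: single-problem summit ⇒ `QuantumAdvantage.QuantumAdvantage` by design

noncomputable section

namespace Summit.QuantumAdvantage.QuantumAdvantage.Theorems.CubicForrelation.NearExactIsExact

open Finset
open Literature.Computability.QuantumComplexity
open Literature.Computability.QuantumComplexity.BuzetChailloux (bxor zeroVec bxor_bxor_cancel_left bxor_zeroVec zeroVec_bxor bxor_comm
  bxor_self twist_zeroVec_right twist_bxor_right)
open Literature.Computability.QuantumComplexity.DerivativeWalsh (W twist_bxor_left)
open Literature.Computability.QuantumComplexity.Simon (twist_eq_one_or)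

/-- **Factorised form of a hyperplane-supported function.**  If `c : 𝔽₂^m → 𝔽₂` has degree `≤ d + 1` and its support lies inside the affine
hyperplane `{⟨x,z⟩ = b}`, `z ≠ 0`, then for some `v` with `⟨v,z⟩ = 1` the derivative `q = c ⊕ c(·⊕v)` has degree `≤ d`, is `v`-periodic, has
twice as many ones as `c`, and `c(x) = [⟨x,z⟩ = b] ∧ q(x)` for every `x` (Kasami–Tokura's type `x₁·q`, coordinate-free).
[this work; cite: KasamiTokura1970, Thm 1] -/
theorem kt3_hyperplane_form {m d : ℕ} (c : (Fin m → Bool) → Bool) (hc : IsDegLeFun (d + 1) c)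
    (z : Fin m → Bool) (hz : z ≠ zeroVec) (b : Bool)
    (hE : ∀ x, c x = true → decide (Odd #(univ.filter fun i => (x i && z i) = true)) = b) :
    ∃ v : Fin m → Bool, decide (Odd #(univ.filter fun i => (v i && z i) = true)) = true ∧
      IsDegLeFun d (fun x => c x ^^ c (bxor x v)) ∧
      (∀ x, (c (bxor x v) ^^ c (bxor (bxor x v) v)) = (c x ^^ c (bxor x v))) ∧
      #(univ.filter fun x => (c x ^^ c (bxor x v)) = true) = 2 * #(univ.filter fun x => c x = true) ∧
      ∀ x, c x = (decide (decide (Odd #(univ.filter fun i => (x i && z i) = true)) = b) && (c x ^^ c (bxor x v))) := by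
  classical
  set S := univ.filter (fun x : Fin m → Bool => c x = true) with hSdef
  set ℓ : (Fin m → Bool) → Bool := fun x => decide (Odd #(univ.filter fun i => (x i && z i) = true)) with hℓdef
  have htw : ∀ x, twist x z = signOf (ℓ x) := fun x => vg_twist_eq_signOf x z
  obtain ⟨v, hv⟩ := es_exists_twist_neg hz
  rw [twist_comm] at hv
  have hℓv1 : ℓ v = true := by
    have h := htw v; rw [hv] at h; revert h; cases ℓ v <;> norm_num [signOf]
  have hℓv : ∀ x, ℓ (bxor x v) = !ℓ x := by
    intro x
    have h := twist_bxor_left x v z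
    rw [htw, htw, hv] at h
    revert h; cases ℓ (bxor x v) <;> cases ℓ x <;> norm_num [signOf]
  have hcv : ∀ x, c x = true → c (bxor x v) = false := by
    intro x hx
    by_contra h
    rw [Bool.not_eq_false] at h
    have h1 := hE x hx
    have h2 := hE (bxor x v) h
    change ℓ x = b at h1
    change ℓ (bxor x v) = b at h2
    rw [hℓv, h1] at h2
    revert h2; cases b <;> simp
  refine ⟨v, hℓv1, stub_derivDegree m d c v hc, fun x => ?_, ?_, fun x => ?_⟩
  · rw [iw_bxor_assoc, BuzetChailloux.bxor_self, bxor_zeroVec, Bool.xor_comm]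
  · have e : (univ.filter fun x => (c x ^^ c (bxor x v)) = true) = S ∪ univ.filter (fun x => c (bxor x v) = true) := by
      ext x
      simp only [hSdef, mem_union, mem_filter, mem_univ, true_and]
      constructor
      · cases hx : c x <;> cases hx' : c (bxor x v) <;> simp
      · rintro (hx | hx)
        · rw [hx, hcv x hx]; rfl
        · have : c x = false := by
            have := hcv _ hx; rwa [iw_bxor_assoc, BuzetChailloux.bxor_self, bxor_zeroVec] at this
          rw [this, hx]; rfl
    have hdisj : Disjoint S (univ.filter fun x => c (bxor x v) = true) := by
      rw [hSdef, disjoint_filter]; intro x _ hx hx'; rw [hcv x hx] at hx'; exact Bool.false_ne_true hx'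
    rw [e, card_union_of_disjoint hdisj]
    have : #(univ.filter fun x => c (bxor x v) = true) = #S := by
      refine card_nbij' (fun x => bxor x v) (fun x => bxor x v) (fun x hx => ?_) (fun x hx => ?_)
        (fun x _ => by simp [iw_bxor_assoc]) (fun x _ => by simp [iw_bxor_assoc])
      · rw [mem_coe, mem_filter] at hx; exact mem_filter.2 ⟨mem_univ _, hx.2⟩
      · rw [mem_coe, mem_filter] at hx ⊢
        refine ⟨mem_univ _, ?_⟩
        rw [iw_bxor_assoc, BuzetChailloux.bxor_self, bxor_zeroVec]; exact hx.2
    rw [this]; ring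
  · change c x = (decide (ℓ x = b) && (c x ^^ c (bxor x v)))
    by_cases hx : c x = true
    · have h1 : ℓ x = b := hE x hx
      rw [hx, hcv x hx, h1]; simp
    · have hx' : c x = false := by simpa using hx
      rw [hx']
      by_cases hxv : c (bxor x v) = true
      · have h2 := hE (bxor x v) hxv
        change ℓ (bxor x v) = b at h2
        rw [hℓv] at h2
        have : ℓ x = !b := by rw [← h2]; simp
        rw [this, hxv]; cases b <;> simp
      · have : c (bxor x v) = false := by simpa using hxv
        rw [this]; simp

end Summit.QuantumAdvantage.QuantumAdvantage.Theorems.CubicForrelation.NearExactIsExact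

end
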